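import Summits.QuantumFields.BalabanUV.T4Continuum.Support.ShellMeasureLevelAssembly

/-!
# `T4Continuum.ShellMeasureRadiusDemand` — WHAT END-II DEMANDS OF SM-L1's RADIUS: a live shell inside the window
# forces `θ(1−ρ) ≤ H`, and then (SM) forces the analyticity radius ratio `R > 7` (indeed `18(1+δ) ≤ δ(R−1)²`);
# below that, END-II's (M1) holds VACUOUSLY (empty shell)
(cell `pub-balaban`, sub-cell `t4`, spine estimate NE7c (node U5b); NE7c formalisation swarm, crew seat
`b2b-balaban-t4-ne7c-formalise-leaf-02` gen 3; a TYPING DIAGNOSTIC on OUR composition END-II, in the genre of the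
typer's T-NE7c-3 and of row S21 `ShellMeasureSmallnessArithmetic` (leaf-01, level-0 regime); imports
`ShellMeasureLevelAssembly` (p206468) ONLY; 0 `def`, 0 sorry; real arithmetic + one measure-zero remark)

HONEST FRAMING.  Finite four-torus programme, rung (B)+1 only — NOT infinite volume, NOT a mass gap, NOT the Clay
problem, NOT summit progress.  NE7c (`T4IndicatorShell.ShellWeightBound`) is NOT PRINTED and NOT PROVED; «NE7c ⇐ the
named binders».  Nothing printed is asserted; nothing landed is false.  This file records, in the kernel, a
QUANTITATIVE DEMAND that our END-II (`ShellMeasureRootCompositionSU2.slotAC_realized_su2_of_levelData` p207698, E2′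
`ShellMeasureRootCompositionLevelZero.slotAC_realized_su2_of_levelData_cube` p208890, one-depth assembly
`ShellMeasureLevelAssembly.slotAntiConcentration_of_levelData` p206468) places on the located binder SM-L1 — the
radius/window RATIO that locator S5 (`XREAD-SM-L1-B11Prop9.md`, C-ne7cleaf02-1 item (i)) found NOT located in print
(«ε₁ so small that»; B11 (172)/Prop. 9, B12 Lemma 4 (3.53) display the radius TYPE `α₃/|B|`, not the ratio).

THE OBSERVATION.  END-II's binders include `hAN` (per window point `x ∈ W` and plaquette `p`: `f` holomorphic on
`‖w‖ < R` with `‖f w‖ ≤ H` there and `f c = hol p (c • x) − 1` on `[0,1]`), `hR : 1 < R`, (SM)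
`36·H/(R − 1)² ≤ δ·θ`, `0 ≤ δ < 1`, `0 ≤ ρ ≤ (1 − δ)/2`, `0 < θ`, and its conclusion is (M1)
`μ{θ(1−ρ) ≤ u < θ} ≤ D·ρ·μ(univ)` for the slot law `μ` read through the chart, `u ∘ section = classifier hPu hol`
(`hudict`) with the chart factor supported in `W` (`hJW`).
* §1 `norm_hol_sub_one_le_of_hAN`, `classifier_le_of_hAN`: since `1 < R`, the point `c = 1` lies on the disc, so
  `‖hol p x − 1‖ = ‖f 1‖ ≤ H` and `classifier hPu hol x ≤ H` for EVERY `x ∈ W` — the tested variable never exceeds `H`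
  on the window.
* §2 `shell_null_of_lt`, `slotAntiConcentration_of_shell_null`: if `u < θ(1−ρ)` almost everywhere, the shell is null
  and (M1) holds for EVERY constant `D` — VACUOUSLY.  Hence END-II carries information at a slot only if the shell
  meets the support: some `x ∈ W`, `p ∈ P_u` with `θ(1−ρ) ≤ ‖hol p x − 1‖`, whence (§1) **`θ(1−ρ) ≤ H`**
  (`live_le_of_witness`).
* §3 THE DEMAND (`radius_demand`, real arithmetic): `θ(1−ρ) ≤ H` ∧ (SM) ∧ `ρ ≤ (1−δ)/2` ∧ `0 ≤ δ < 1` ∧ `0 < θ` ∧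
  `1 < R`
  ⟹ `0 < δ`, `18·(1 + δ) ≤ δ·(R − 1)²` and **`7 < R`**; in file 7″'s chart-ray currency `R = r_Φ/S`
  (`radius_demand_chartRay`): **`7·S < r_Φ`** — the coarse-field map / minimiser must be analytic, with the (SM)-sized
  modulus bound, on a polydisc MORE THAN SEVEN TIMES the chart window.  `radius_demand_of_witness` = §1 + §3 from
  END-II's own binders plus one shell point in the window.
READING (located, not asserted).  Print's radius TYPE is `α₃/|B|` with `|B|` of window size (B12 (3.53); B11 (172)), so
the printed ratio grows like `α₃/ε` as the window shrinks — the demand `> 7` is met in kind for small windows and is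
NOT an obstruction; it is the NUMBER our composition asks of the «sufficiently small» sentences, typed.  Consumers: the
owner / typer census of SM-L1 (G-ne7cp1-14 (i)), S21's radius scaling law `r₀/θ ≤ Rad` (which needs `r₀ > 7θ` at a
live slot), file 7″ `ShellMeasureLandauHolonomyChart.hAN_landau_chartRay` (`S < r_Φ` is necessary, `7S < r_Φ` is what a
live slot needs).  NE7c NOT PROVED; spine PROVED 0/9.  HONEST DEPENDENCY (cell): continuum YM on T⁴ ⇐ BetaPertH ∧ nine
spine estimates (0/9 proved); BetaPertH ⇐ (D1) ∧ (D4) ∧ CAP+tail; G-an2-4 gates asym, D1 and NE2/3/4.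
-/

noncomputable section

open Set Metric MeasureTheory

namespace Summit.QuantumFields.BalabanUV.T4Continuum.ShellMeasureRadiusDemand

open Literature.MathematicalPhysics.QuantumFieldTheory.Balaban1983to89
open T4ShellMeasure (SlotAntiConcentration)
open ShellMeasureLevelAssembly (classifier)

/-! ## §1 On the window the tested variable never exceeds `H` -/

section Window

variable {E : Type*} [NormedAddCommGroup E] [NormedSpace ℝ E]
variable {A : Type*} [NormedRing A] [NormedAlgebra ℂ A] [CompleteSpace A]

omit [CompleteSpace A] in
/-- `c = 1` lies on END-II's disc (`1 < R`), so the (AN-bound) witness bounds the holonomy deviation AT the window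
point: `‖hol p x − 1‖ = ‖f 1‖ ≤ H`. [folklore] -/
theorem norm_hol_sub_one_le_of_hAN {R H : ℝ} (hR : 1 < R) {hol : E → A} {x : E}
    (hAN : ∃ f : ℂ → A, DifferentiableOn ℂ f (ball 0 R) ∧ (∀ w ∈ ball (0 : ℂ) R, ‖f w‖ ≤ H) ∧ f 0 = 0 ∧
      ∀ c : ℝ, 0 ≤ c → c ≤ 1 → f (c : ℂ) = hol (c • x) - 1) :
    ‖hol x - 1‖ ≤ H := by
  obtain ⟨f, -, hfb, -, hfc⟩ := hAN
  have h1 : ((1 : ℝ) : ℂ) ∈ ball (0 : ℂ) R := by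
    rw [mem_ball_zero_iff, Complex.norm_real, norm_one]; exact hR
  have h := hfb _ h1
  rwa [hfc 1 zero_le_one le_rfl, one_smul] at h

omit [CompleteSpace A] in
/-- **THE CLASSIFIER NEVER EXCEEDS `H` ON THE WINDOW.**  END-II's `hAN` binder (at the window point `x`, for every
classifier plaquette) and `1 < R` give `classifier hPu hol x ≤ H`. [folklore] -/
theorem classifier_le_of_hAN {ι : Type*} {Pu : Finset ι} (hPu : Pu.Nonempty) {hol : ι → E → A} {R H : ℝ}
    (hR : 1 < R) {x : E}
    (hAN : ∀ p ∈ Pu, ∃ f : ℂ → A, DifferentiableOn ℂ f (ball 0 R) ∧ (∀ w ∈ ball (0 : ℂ) R, ‖f w‖ ≤ H) ∧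
      f 0 = 0 ∧ ∀ c : ℝ, 0 ≤ c → c ≤ 1 → f (c : ℂ) = hol p (c • x) - 1) :
    classifier hPu hol x ≤ H := by
  unfold classifier
  exact Finset.sup'_le hPu _ fun p hp => norm_hol_sub_one_le_of_hAN hR (hAN p hp)

omit [CompleteSpace A] in
/-- **A LIVE SHELL POINT IN THE WINDOW FORCES `θ(1−ρ) ≤ H`.**  If some window point `x ∈ W` and classifier plaquette
`p ∈ P_u` reach the shell, `θ(1−ρ) ≤ ‖hol p x − 1‖`, then END-II's `hAN` + `1 < R` give `θ(1−ρ) ≤ H`. [folklore] -/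
theorem live_le_of_witness {ι : Type*} {Pu : Finset ι} {hol : ι → E → A} {W : Set E} {R H θ ρ : ℝ} (hR : 1 < R)
    (hAN : ∀ x ∈ W, ∀ p ∈ Pu, ∃ f : ℂ → A, DifferentiableOn ℂ f (ball 0 R) ∧ (∀ w ∈ ball (0 : ℂ) R, ‖f w‖ ≤ H) ∧
      f 0 = 0 ∧ ∀ c : ℝ, 0 ≤ c → c ≤ 1 → f (c : ℂ) = hol p (c • x) - 1)
    (hwit : ∃ x ∈ W, ∃ p ∈ Pu, θ * (1 - ρ) ≤ ‖hol p x - 1‖) : θ * (1 - ρ) ≤ H := by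
  obtain ⟨x, hx, p, hp, hle⟩ := hwit
  exact hle.trans (norm_hol_sub_one_le_of_hAN hR (hAN x hx p hp))

end Window

/-! ## §2 Below the shell END-II's (M1) is vacuous -/

section Vacuous

variable {Ω : Type*} [MeasurableSpace Ω]

/-- if the tested variable stays below `θ(1−ρ)` almost everywhere, the shell `{θ(1−ρ) ≤ u < θ}` is null. [folklore] -/
theorem shell_null_of_lt (μ : Measure Ω) {u : Ω → ℝ} {θ ρ : ℝ} (h : ∀ᵐ ω ∂μ, u ω < θ * (1 - ρ)) :
    μ {ω | θ * (1 - ρ) ≤ u ω ∧ u ω < θ} = 0 := by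
  refine measure_mono_null (fun ω hω => ?_) (ae_iff.1 h)
  exact fun hlt => absurd hω.1 (not_le.2 hlt)

/-- **VACUITY.**  A null shell makes (M1) `SlotAntiConcentration μ u θ ρ D` true for EVERY constant `D` — the
conclusion of END-II then carries no information about the slot. [folklore] -/
theorem slotAntiConcentration_of_shell_null (μ : Measure Ω) {u : Ω → ℝ} {θ ρ : ℝ}
    (h : μ {ω | θ * (1 - ρ) ≤ u ω ∧ u ω < θ} = 0) (D : ℝ) : SlotAntiConcentration μ u θ ρ D := by
  unfold SlotAntiConcentration
  rw [h]
  exact zero_le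

/-- the two remarks in one: `u < θ(1−ρ)` a.e. ⟹ (M1) for every `D`. [folklore] -/
theorem slotAntiConcentration_of_lt (μ : Measure Ω) {u : Ω → ℝ} {θ ρ : ℝ}
    (h : ∀ᵐ ω ∂μ, u ω < θ * (1 - ρ)) (D : ℝ) : SlotAntiConcentration μ u θ ρ D :=
  slotAntiConcentration_of_shell_null μ (shell_null_of_lt μ h) D

end Vacuous

/-! ## §3 The demand on the radius ratio -/

/-- **THE RADIUS DEMAND (real arithmetic).**  From `θ(1−ρ) ≤ H` (a live shell point, §1), END-II's (SM)
`36·H/(R−1)² ≤ δ·θ`, `1 < R`, `0 < θ`, `0 ≤ δ < 1` and `ρ ≤ (1−δ)/2`: `0 < δ`, `18·(1+δ) ≤ δ·(R−1)²`, and `7 < R`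
(`0 ≤ δ` is needed: with `δ < 0` the system admits `R = 2`). [folklore] -/
theorem radius_demand {θ ρ δ H R : ℝ} (hθ : 0 < θ) (hδ0 : 0 ≤ δ) (hδ1 : δ < 1) (hρ : ρ ≤ (1 - δ) / 2)
    (hR : 1 < R) (hSM : 36 * H / (R - 1) ^ 2 ≤ δ * θ) (hlive : θ * (1 - ρ) ≤ H) :
    0 < δ ∧ 18 * (1 + δ) ≤ δ * (R - 1) ^ 2 ∧ 7 < R := by
  have hR1 : 0 < (R - 1) ^ 2 := by positivity
  have hSM' : 36 * H ≤ δ * θ * (R - 1) ^ 2 := (div_le_iff₀ hR1).1 hSM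
  have h1ρ : (1 + δ) / 2 ≤ 1 - ρ := by linarith
  have hθρ : θ * ((1 + δ) / 2) ≤ θ * (1 - ρ) := mul_le_mul_of_nonneg_left h1ρ hθ.le
  -- 18 θ (1+δ) ≤ 36 θ(1−ρ) ≤ 36 H ≤ δ θ (R−1)²
  have key : θ * (18 * (1 + δ)) ≤ θ * (δ * (R - 1) ^ 2) := by nlinarith
  have key' : 18 * (1 + δ) ≤ δ * (R - 1) ^ 2 := le_of_mul_le_mul_left key hθ
  have hδ : 0 < δ := by
    by_contra hδ'
    have hδle : δ ≤ 0 := not_lt.1 hδ'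
    have : δ * (R - 1) ^ 2 ≤ 0 := mul_nonpos_of_nonpos_of_nonneg hδle hR1.le
    linarith
  refine ⟨hδ, key', ?_⟩
  -- δ(R−1)² ≥ 18(1+δ) > 36δ since δ < 1, hence (R−1)² > 36
  have h36 : 36 * δ < δ * (R - 1) ^ 2 := by nlinarith
  have hsq : 36 < (R - 1) ^ 2 := by
    by_contra hle
    have hle' : (R - 1) ^ 2 ≤ 36 := not_lt.1 hle
    have := mul_le_mul_of_nonneg_left hle' hδ.le
    linarith
  nlinarith

/-- the same with END-II v1's literal (SM) shape `36 * H * 1 ^ 2 / (R - 1) ^ 2 ≤ δ * θ` (typer T-NE7c-2). [folklore] -/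
theorem radius_demand' {θ ρ δ H R : ℝ} (hθ : 0 < θ) (hδ0 : 0 ≤ δ) (hδ1 : δ < 1) (hρ : ρ ≤ (1 - δ) / 2)
    (hR : 1 < R) (hSM : 36 * H * 1 ^ 2 / (R - 1) ^ 2 ≤ δ * θ) (hlive : θ * (1 - ρ) ≤ H) :
    0 < δ ∧ 18 * (1 + δ) ≤ δ * (R - 1) ^ 2 ∧ 7 < R :=
  radius_demand hθ hδ0 hδ1 hρ hR (by simpa using hSM) hlive

/-- **THE DEMAND IN FILE 7″'s CHART-RAY CURRENCY** `R = r_Φ/S` (window radius `S`, analyticity polydisc `r_Φ` of the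
coarse-field map): a live slot needs `7·S < r_Φ`. [folklore] -/
theorem radius_demand_chartRay {θ ρ δ H S rΦ : ℝ} (hθ : 0 < θ) (hδ0 : 0 ≤ δ) (hδ1 : δ < 1)
    (hρ : ρ ≤ (1 - δ) / 2) (hS : 0 < S) (hR : 1 < rΦ / S) (hSM : 36 * H / (rΦ / S - 1) ^ 2 ≤ δ * θ)
    (hlive : θ * (1 - ρ) ≤ H) : 7 * S < rΦ := by
  have h := (radius_demand hθ hδ0 hδ1 hρ hR hSM hlive).2.2
  rwa [lt_div_iff₀ hS] at h

section Composite

variable {E : Type*} [NormedAddCommGroup E] [NormedSpace ℝ E]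
variable {A : Type*} [NormedRing A] [NormedAlgebra ℂ A] [CompleteSpace A]

omit [CompleteSpace A] in
/-- **END-II's OWN BINDERS + ONE LIVE SHELL POINT IN THE WINDOW ⟹ `R > 7`.**  Binders copied from END-II: `hAN` (on
`ball 0 R`), `hR : 1 < R`, (SM), `0 < θ`, `0 ≤ δ < 1`, `ρ ≤ (1−δ)/2`; plus the non-vacuity witness `∃ x ∈ W, ∃ p ∈ P_u,
θ(1−ρ) ≤ ‖hol p x − 1‖` (without which the shell misses the window and (M1) is vacuous, §2).  CONCLUSION: `0 < δ`,
`18(1+δ) ≤ δ(R−1)²`, `7 < R`. [folklore] -/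
theorem radius_demand_of_witness {ι : Type*} {Pu : Finset ι} {hol : ι → E → A} {W : Set E} {R H θ ρ δ : ℝ}
    (hR : 1 < R)
    (hAN : ∀ x ∈ W, ∀ p ∈ Pu, ∃ f : ℂ → A, DifferentiableOn ℂ f (ball 0 R) ∧ (∀ w ∈ ball (0 : ℂ) R, ‖f w‖ ≤ H) ∧
      f 0 = 0 ∧ ∀ c : ℝ, 0 ≤ c → c ≤ 1 → f (c : ℂ) = hol p (c • x) - 1)
    (hθ : 0 < θ) (hδ0 : 0 ≤ δ) (hδ1 : δ < 1) (hρ : ρ ≤ (1 - δ) / 2) (hSM : 36 * H / (R - 1) ^ 2 ≤ δ * θ)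
    (hwit : ∃ x ∈ W, ∃ p ∈ Pu, θ * (1 - ρ) ≤ ‖hol p x - 1‖) :
    0 < δ ∧ 18 * (1 + δ) ≤ δ * (R - 1) ^ 2 ∧ 7 < R :=
  radius_demand hθ hδ0 hδ1 hρ hR hSM (live_le_of_witness hR hAN hwit)

end Composite

/-- **THE CONSTANT IS NEARLY SHARP.**  `R = 8` is admissible: `δ = 36/49`, `ρ = 13/98 = (1−δ)/2`, `θ = 1`,
`H = 85/98 = θ(1−ρ)` meet every hypothesis of `radius_demand` (as `δ ↑ 1` the admissible radii approach `7`; only the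
instance `R = 8` is checked here). [folklore] -/
theorem radius_demand_witness :
    ∃ θ ρ δ H R : ℝ, 0 < θ ∧ δ < 1 ∧ 0 ≤ δ ∧ 0 ≤ ρ ∧ ρ ≤ (1 - δ) / 2 ∧ 1 < R ∧
      36 * H / (R - 1) ^ 2 ≤ δ * θ ∧ θ * (1 - ρ) ≤ H ∧ R = 8 := by
  refine ⟨1, 13 / 98, 36 / 49, 85 / 98, 8, by norm_num, by norm_num, by norm_num, by norm_num, by norm_num,
    by norm_num, by norm_num, by norm_num, rfl⟩

end Summit.QuantumFields.BalabanUV.T4Continuum.ShellMeasureRadiusDemand
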